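import Summits.QuantumFields.QCD.Theorems.WindowExtinction.Negative.CoercivityDefectNearRoot
import Literature.MathematicalPhysics.QuantumLattice.OverlapLocality
import HarnessLib

/-!
# Transport of the negative count of `Γ₅ D_W(U,m,1)` from `m = −1` under the HJL gap
# (helper `flux_transport_of_HJL` of stub S11 `stub_periodicIndexCarrier`)

Helper of the residual stub S11 `stub_periodicIndexCarrier` of line `free-volume-heavy-witness`
(reshape r4) of crux `Summit.QuantumFields.QCD.Theses.SpectralDefectExtinction.WindowExtinction`
(item stmt-QuantumFields-8964), lead c3 wave 2.

CONDITIONAL on the named published fact `HJLLocality (fundamentalRep (Fin 3))`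
(Hernández–Jansen–Lüscher 1999, (2.16): for a norm-admissible `SU(3)` field,
`Σ_i ‖(D_W(U,−1,1)ψ)_i‖² ≥ (1 − 30ε) Σ_i ‖ψ_i‖²`), taken as a hypothesis: for a norm-admissible field
`U` with `30ε < lo²`, `0 < lo`, and every `δ ∈ [lo, 1]`,

* `fluxHJL_mulVec_eq_zero` — `D_W(U,−δ,1)` is injective: a kernel vector `ψ` has
  `D_W(U,−1,1)ψ = (δ − 1)ψ`, so the gap gives `(1 − 30ε)‖ψ‖² ≤ (1 − δ)²‖ψ‖²`, impossible for
  `ψ ≠ 0` since `(1 − δ)² ≤ 1 − δ ≤ 1 − lo ≤ 1 − lo² < 1 − 30ε`;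
* `fluxHJL_no_realMode` — hence the massless operator `D_W(U,0,1)` has no real characteristic root
  in `[lo, 1]` (an eigenvector of a real root `μ` lies in the kernel of `D_W(U,−μ,1)`);
* `flux_transport_of_HJL` — so `det (Γ₅ D_W(U,−δ,1)) ≠ 0` and, by the spectral flow inequality
  `negCount_sub_negCount_le_realModes` (levels of `Γ₅ D_W(U,m,1)` cross zero only at `m = −μ` for real
  modes `μ`), the negative count of `Γ₅ D_W(U,−δ,1)` equals that of `Γ₅ D_W(U,−1,1)`.

References: P. Hernández, K. Jansen, M. Lüscher, Nucl. Phys. B 552 (1999) 363 [hep-lat/9808010],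
(2.15)–(2.16); R. G. Edwards, U. M. Heller, R. Narayanan, Nucl. Phys. B 535 (1998) 403 (level
crossings ⟺ real modes).
-/

noncomputable section

namespace Summit.QuantumFields.QCD.Cruxes.WindowExtinction.FreeVolumeHeavyWitness

open Matrix
open Literature.MathematicalPhysics.QuantumLattice Literature.MathematicalPhysics.QuantumFieldTheory
  Literature.Probability.LatticeModels
open Summit.QuantumFields.QCD.Theorems.ExtinctionBuildsQCD.Negative
open Summit.QuantumFields.QCD.Theorems.WindowExtinction.Negative
open scoped BigOperators

/-- `D_W(U,−δ,1) = D_W(U,−1,1) + (1 − δ)·1` (the bare mass enters additively). -/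
theorem fluxHJL_wilsonDirac_neg_eq {L : ℕ} [NeZero L] (U : GaugeConfig 4 L SU3) (δ : ℝ) :
    wilsonDirac (fundamentalRep (Fin 3)) U (-δ) 1 =
      wilsonDirac (fundamentalRep (Fin 3)) U (-1) 1 + ((1 - δ : ℝ) : ℂ) • (1 : Matrix _ _ ℂ) := by
  have hρ : ∀ g : SU3, fundamentalRep (Fin 3) g ∈ Matrix.unitaryGroup (Fin 3) ℂ :=
    fundamentalRep_mem_unitaryGroup
  rw [wilsonDirac_eq_add_mass _ hρ U (-δ), wilsonDirac_eq_add_mass _ hρ U (-1), add_assoc, ← add_smul]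
  congr 2
  push_cast
  ring

/-- **Injectivity of `D_W(U,−δ,1)` under the HJL gap.**  If `HJLLocality` holds for the fundamental
representation, `U` is `ε`-norm-admissible, `0 < lo`, `30ε < lo²`, and `δ ∈ [lo, 1]`, then
`D_W(U,−δ,1)ψ = 0` forces `ψ = 0`: the kernel equation reads `D_W(U,−1,1)ψ = (δ − 1)ψ`, so the gap
`(1 − 30ε)‖ψ‖² ≤ ‖D_W(U,−1,1)ψ‖² = (1 − δ)²‖ψ‖²` contradicts `(1 − δ)² ≤ 1 − lo < 1 − 30ε`. -/
theorem fluxHJL_mulVec_eq_zero {L : ℕ} [NeZero L] (U : GaugeConfig 4 L SU3) {ε lo : ℝ}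
    (hHJL : HJLLocality (fundamentalRep (Fin 3))) (hadm : IsNormAdmissible (fundamentalRep (Fin 3)) U ε)
    (hlo : 0 < lo) (hε : 30 * ε < lo ^ 2) {δ : ℝ} (hloδ : lo ≤ δ) (hδ1 : δ ≤ 1)
    {ψ : TorusSite 4 L × Fin 3 × Fin 4 → ℂ}
    (hψ : wilsonDirac (fundamentalRep (Fin 3)) U (-δ) 1 *ᵥ ψ = 0) : ψ = 0 := by
  have hρ : ∀ g : SU3, fundamentalRep (Fin 3) g ∈ Matrix.unitaryGroup (Fin 3) ℂ :=
    fundamentalRep_mem_unitaryGroup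
  by_contra hne
  -- the kernel equation at mass `−1`
  have hker : wilsonDirac (fundamentalRep (Fin 3)) U (-1) 1 *ᵥ ψ = ((δ - 1 : ℝ) : ℂ) • ψ := by
    have h := hψ
    rw [fluxHJL_wilsonDirac_neg_eq U δ, add_mulVec, smul_mulVec, one_mulVec,
      add_eq_zero_iff_eq_neg, ← neg_smul] at h
    rw [h]
    congr 1
    push_cast
    ring
  -- the HJL gap on `ψ`
  have hgap := hHJL.1 hρ U ε hadm ψ
  rw [hker, sum_norm_sq_smul, Complex.norm_real, Real.norm_eq_abs, sq_abs] at hgap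
  have hS : 0 < ∑ i, ‖ψ i‖ ^ 2 := sum_norm_sq_pos hne
  have h1 : 1 - 30 * ε ≤ (δ - 1) ^ 2 := le_of_mul_le_mul_right hgap hS
  have h2 : (δ - 1) ^ 2 ≤ 1 - δ := by nlinarith
  have h3 : lo ^ 2 ≤ lo := by nlinarith
  linarith

/-- **No real modes of the massless operator in `[lo, 1]`.**  Under the same hypotheses, no
characteristic root `μ` of `D_W(U,0,1)` has `Im μ = 0` and `lo ≤ Re μ ≤ 1`: its eigenvector would lie
in the kernel of `D_W(U,−Re μ,1) = D_W(U,0,1) − (Re μ)·1`. -/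
theorem fluxHJL_no_realMode {L : ℕ} [NeZero L] (U : GaugeConfig 4 L SU3) {ε lo : ℝ}
    (hHJL : HJLLocality (fundamentalRep (Fin 3))) (hadm : IsNormAdmissible (fundamentalRep (Fin 3)) U ε)
    (hlo : 0 < lo) (hε : 30 * ε < lo ^ 2) {μ : ℂ}
    (hμ : μ ∈ (wilsonDirac (fundamentalRep (Fin 3)) U 0 1).charpoly.roots) (him : μ.im = 0)
    (hlo' : lo ≤ μ.re) (h1 : μ.re ≤ 1) : False := by
  have hρ : ∀ g : SU3, fundamentalRep (Fin 3) g ∈ Matrix.unitaryGroup (Fin 3) ℂ :=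
    fundamentalRep_mem_unitaryGroup
  obtain ⟨v, hv, hDv⟩ := exists_eigenvector_of_mem_roots_charpoly _ hμ
  have hreal : ((μ.re : ℝ) : ℂ) = μ := Complex.ext (by simp) (by simp [him])
  have hker : wilsonDirac (fundamentalRep (Fin 3)) U (-μ.re) 1 *ᵥ v = 0 := by
    rw [wilsonDirac_eq_add_mass _ hρ U (-μ.re), add_mulVec, smul_mulVec, one_mulVec,
      hDv, ← add_smul, Complex.ofReal_neg, hreal, add_neg_cancel, zero_smul]
  exact hv (fluxHJL_mulVec_eq_zero U hHJL hadm hlo hε hlo' h1 hker)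

/-- **Helper `flux_transport_of_HJL` (S11, conditional on HJL).**  Assume the named fact
`HJLLocality (fundamentalRep (Fin 3))` (Hernández–Jansen–Lüscher (2.16): the Hermitian Wilson kernel at
the overlap point `m = −1` has the gap `A†A ≥ 1 − 30ε` on `ε`-norm-admissible fields).  Then for every
periodic four-torus, every `ε`-norm-admissible `SU(3)` field `U`, and `0 < lo` with `30ε < lo²`: for all
`δ ∈ [lo, 1]` the Hermitian Wilson–Dirac operator `Γ₅ D_W(U,−δ,1)` is nonsingular and has the same
number of negative eigenvalues as `Γ₅ D_W(U,−1,1)`.  Proof: `D_W(U,−δ,1)` is injective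
(`fluxHJL_mulVec_eq_zero`), so its determinant and that of `Γ₅ D_W` (`Γ₅² = 1`) are nonzero; the
spectral flow inequality `negCount_sub_negCount_le_realModes` bounds the change of the negative count
between `m = −1` and `m = −δ` by the number of real modes of `D_W(U,0,1)` in `[δ, 1]`, which is zero
(`fluxHJL_no_realMode`). -/
theorem flux_transport_of_HJL :
    ∀ (L : ℕ) [NeZero L] (U : GaugeConfig 4 L SU3) (ε lo : ℝ),
      HJLLocality (fundamentalRep (Fin 3)) → IsNormAdmissible (fundamentalRep (Fin 3)) U ε →
      0 < lo → 30 * ε < lo ^ 2 →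
      ∀ δ : ℝ, lo ≤ δ → δ ≤ 1 →
        (spinorLift gammaFive * wilsonDirac (fundamentalRep (Fin 3)) U (-δ) 1).det ≠ 0 ∧
        (spinorLift gammaFive * wilsonDirac (fundamentalRep (Fin 3)) U (-δ) 1).charpoly.roots.countP
            (fun z : ℂ => z.re < 0) =
          (spinorLift gammaFive * wilsonDirac (fundamentalRep (Fin 3)) U (-1) 1).charpoly.roots.countP
            (fun z : ℂ => z.re < 0) := by
  intro L _ U ε lo hHJL hadm hlo hε δ hloδ hδ1
  have hρ : ∀ g : SU3, fundamentalRep (Fin 3) g ∈ Matrix.unitaryGroup (Fin 3) ℂ :=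
    fundamentalRep_mem_unitaryGroup
  refine ⟨?_, ?_⟩
  · -- nonsingularity
    rw [det_mul]
    refine mul_ne_zero ?_ ?_
    · have h := congrArg Matrix.det
        (spinorLift_gammaFive_mul_self (L := L) (N := 3))
      rw [det_mul, det_one] at h
      exact left_ne_zero_of_mul_eq_one h
    · intro hdet
      obtain ⟨v, hv, hv0⟩ := Matrix.exists_mulVec_eq_zero_iff.2 hdet
      exact hv (fluxHJL_mulVec_eq_zero U hHJL hadm hlo hε hloδ hδ1 hv0)
  · -- transport of the negative count
    have hflow := negCount_sub_negCount_le_realModes (fundamentalRep (Fin 3)) hρ U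
      (show (-1 : ℝ) ≤ -δ by linarith)
    have hzero : (wilsonDirac (fundamentalRep (Fin 3)) U 0 1).charpoly.roots.countP
        (fun μ : ℂ => μ.im = 0 ∧ (-1 : ℝ) ≤ -μ.re ∧ -μ.re ≤ -δ) = 0 := by
      rw [Multiset.countP_eq_zero]
      rintro μ hμ ⟨him, h1, h2⟩
      exact fluxHJL_no_realMode U hHJL hadm hlo hε hμ him (by linarith) (by linarith)
    rw [hzero, Nat.cast_zero] at hflow
    have h := abs_nonpos_iff.1 hflow
    rw [sub_eq_zero] at h
    exact_mod_cast h.symm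

end Summit.QuantumFields.QCD.Cruxes.WindowExtinction.FreeVolumeHeavyWitness

end
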